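import Summits.QuantumFields.YangMills.Theorems.LuscherReductionTwistedTraceScalingBOCoreTransfer
import Summits.QuantumFields.YangMills.Theorems.LuscherReductionTwistedTraceScalingOrthoTransverseRotation
import Summits.QuantumFields.YangMills.Theorems.LuscherReductionTwistedTraceScalingSlowDisintegrationTubes
import HarnessLib

/-!
# (C2-moments, step (iv-b)) COLOUR REMOVAL IN THE OUTPUT INTEGRATION: against a colour-rotation invariant fibre weight, the conjugated central transfer
# `fpFibreTransfer β Ω W (c⁻¹(oT 1 v)c) 1` integrates like the un-conjugated one — `∫ G(v)·T(c⁻¹(oT 1 v)c) dπ(v) = ∫ G(v)·T(oT 1 v) dπ(v)`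
# (memo `Cruxes/NearFlatRatioLaw/Lines/ratepack-v7-moments-g18.md` §5 (A4); route `FlatTubeReduction`, crux K1 `NearFlatRatioLaw` stmt-QuantumFields-24720, line «ratepack_v2» skeleton v6,
# stub `stub_hODpot_A`; seat `ym-line-ftr-p1` g18; R2b1 RECORD rung — no summit statement is proved here)

WHY.  The Cauchy–Schwarz form of the core-transfer defect (`…CoreTransferMomentsCS`) carries colour-averaged reweighted central transfers `∫_c ρ_c·T[m](c⁻¹(oT 1 x')c) dc`; in the output
integration over the fibre point `x'` against the colour-blind weight `𝟙_in(x')e^{−q(x')}e^{−β²‖P_Γx'‖²}` the conjugation by `c` can be removed fibre by fibre, because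
`c⁻¹(oT 1 v)c = oT 1 (R_{c⁻¹}v)` on the cap (`…BOCoreTransfer.fpFibreTransfer_conj_orthoTube`, `c⁻¹·1·c = 1`) and `π` is colour-rotation invariant (`orthoTransverse_map_colourRotate`).
* §1 `measurable_fpFibreTransfer_out` — `U ↦ fpFibreTransfer β Ω W U u` is measurable; `conj_one_site_one`;
* §2 ★★ `integral_mul_fpFibreTransfer_conj_eq` — the colour removal identity for any measurable colour-invariant `G`.
HONEST FRAMING: measure-theoretic bookkeeping for a stub of the CONDITIONAL reduction route R2b1 (rate twin); femto rung R2b1 (RECORD label); not infinite volume, not a mass gap,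
not Clay.  No defs, no named facts, no `sorry`.
-/

set_option autoImplicit false

noncomputable section

open MeasureTheory Filter Topology Real
open scoped BigOperators
open Literature.MathematicalPhysics.QuantumFieldTheory
open Literature.MathematicalPhysics.QuantumLattice

namespace Summit.QuantumFields.YangMills.Theorems.FemtoTransferGap.TwoLattice.ConstTube

open Summit.QuantumFields.YangMills.Theorems.FemtoTransferGap
open Summit.QuantumFields.YangMills.Theorems.FemtoTransferGap.TwoLattice
open Summit.QuantumFields.YangMills.Theorems.FemtoTransferGap.TwoLattice.Avg
open Summit.QuantumFields.YangMills.Theorems.FemtoTransferGap.TwoLattice.Stiff (LinkSpace)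
open Summit.QuantumFields.YangMills.Theorems.TwistedTraceScaling.Negative.R33 (gaugeTransform_const_orthoTube)

variable {L : ℕ} [NeZero L]

/-! ## §1 Measurability in the output point; conjugating the identity -/

/-- `U ↦ fpFibreTransfer β Ω W U u` is measurable. [folklore] -/
theorem measurable_fpFibreTransfer_out (β : ℝ) {Ω : LinkSpace L → ℝ} (hΩ : Measurable Ω) {W : (Site 3 L → SU2) → ℝ} (hW : Measurable W) (u : GaugeConfig 3 1 SU2) :
    Measurable fun U : GaugeConfig 3 L SU2 => fpFibreTransfer L β Ω W U u := by
  haveI : SecondCountableTopology SU2 := secondCountableTopology_su2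
  haveI := isFiniteMeasure_orthoTransverse L
  have hK : Measurable fun p : GaugeConfig 3 L SU2 × GaugeConfig 3 L SU2 => transferKernel su2Rep β p.1 p.2 :=
    (continuous_transferKernel su2Rep continuous_su2Rep β).measurable
  have h2 : Measurable fun q : GaugeConfig 3 L SU2 × ((Edge 3 L → Fin 3 → ℝ) × (Site 3 L → SU2)) => gaugeTransform q.2.2 (orthoTube L u q.2.1) := by
    have ha : Measurable fun q : GaugeConfig 3 L SU2 × ((Edge 3 L → Fin 3 → ℝ) × (Site 3 L → SU2)) => (orthoTube L u q.2.1, q.2.2) :=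
      ((measurable_orthoTube_right (L := L) u).comp (measurable_fst.comp measurable_snd)).prodMk (measurable_snd.comp measurable_snd)
    have h := (measurable_gaugeAction (L := L)).comp ha
    simpa only [Function.comp_def] using h
  have h3 : Measurable fun q : GaugeConfig 3 L SU2 × ((Edge 3 L → Fin 3 → ℝ) × (Site 3 L → SU2)) => transferKernel su2Rep β q.1 (gaugeTransform q.2.2 (orthoTube L u q.2.1)) := by
    have h := hK.comp (measurable_fst.prodMk h2); simpa only [Function.comp_def] using h
  have hF : Measurable fun q : GaugeConfig 3 L SU2 × ((Edge 3 L → Fin 3 → ℝ) × (Site 3 L → SU2)) =>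
      W q.2.2 * transferKernel su2Rep β q.1 (gaugeTransform q.2.2 (orthoTube L u q.2.1)) * Ω (linkEmbed L q.2.1) :=
    ((hW.comp (measurable_snd.comp measurable_snd)).mul h3).mul (hΩ.comp ((measurable_linkEmbed L).comp (measurable_fst.comp measurable_snd)))
  have h := (hF.stronglyMeasurable.integral_prod_right' (ν := (orthoTransverse L).prod (gaugeMeasure L))).measurable
  unfold fpFibreTransfer
  simpa only using h

/-- Conjugating the identity one-site configuration by a constant gauge transformation does nothing. [folklore] -/
theorem conj_one_site_one (c : SU2) : gaugeTransform (fun _ : Site 3 1 => c⁻¹) (1 : GaugeConfig 3 1 SU2) = 1 := by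
  funext e; show c⁻¹ * 1 * c⁻¹⁻¹ = 1; group

/-! ## §2 ★★ Colour removal -/

/-- ★★ **COLOUR REMOVAL IN THE OUTPUT INTEGRATION**: for a measurable colour-invariant fibre weight `G` (`G(R_{c⁻¹}v) = G(v)`) and measurable `Ω, W`,
`∫ G(v)·fpFibreTransfer β Ω W (c⁻¹(oT 1 v)c) 1 dπ(v) = ∫ G(v)·fpFibreTransfer β Ω W (oT 1 v) 1 dπ(v)`. [folklore] -/
theorem integral_mul_fpFibreTransfer_conj_eq (β : ℝ) {Ω : LinkSpace L → ℝ} (hΩm : Measurable Ω)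
    {W : (Site 3 L → SU2) → ℝ} (hW : Measurable W) (c : SU2)
    {G : (Edge 3 L → Fin 3 → ℝ) → ℝ} (hGm : Measurable G) (hG : ∀ v, G (colourRotate L (fun _ => c⁻¹) v) = G v) :
    ∫ v, G v * fpFibreTransfer L β Ω W (gaugeTransform (fun _ : Site 3 L => c⁻¹) (orthoTube L 1 v)) 1 ∂orthoTransverse L =
      ∫ v, G v * fpFibreTransfer L β Ω W (orthoTube L 1 v) 1 ∂orthoTransverse L := by
  set R : (Edge 3 L → Fin 3 → ℝ) → (Edge 3 L → Fin 3 → ℝ) := colourRotate L (fun _ => c⁻¹) with hR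
  set F : (Edge 3 L → Fin 3 → ℝ) → ℝ := fun w => fpFibreTransfer L β Ω W (orthoTube L 1 w) 1 with hF
  have hFm : Measurable F := (measurable_fpFibreTransfer_out β hΩm hW 1).comp (measurable_orthoTube_right (L := L) 1)
  have hRm : Measurable R := measurable_colourRotate L _
  -- a.e. on the cap: `c⁻¹(oT 1 v)c = oT 1 (R v)`
  have hae : ∀ᵐ v ∂orthoTransverse L, G v * fpFibreTransfer L β Ω W (gaugeTransform (fun _ : Site 3 L => c⁻¹) (orthoTube L 1 v)) 1 = (fun w => G w * F w) (R v) := by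
    have hnull := orthoTransverse_compl_capBalancedSet (L := L)
    filter_upwards [measure_eq_zero_iff_ae_notMem.mp hnull] with v hv
    have hv' : v ∈ capBalancedSet L := not_not.mp (by simpa using hv)
    show _ = G (R v) * F (R v)
    rw [hF, hR, fpFibreTransfer_conj_orthoTube β Ω W c 1 1 hv', conj_one_site_one, hG]
  rw [integral_congr_ae hae]
  -- change of variables `v ↦ R v` under the rotation invariant `π`
  have hGF : AEStronglyMeasurable (fun w => G w * F w) ((orthoTransverse L).map R) := (hGm.mul hFm).aestronglyMeasurable
  rw [← integral_map hRm.aemeasurable hGF, orthoTransverse_map_colourRotate]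

end Summit.QuantumFields.YangMills.Theorems.FemtoTransferGap.TwoLattice.ConstTube

end
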